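import Mathlib
import Summits.MatrixMultiplication.MatrixMultiplication.Theorems.SnSubsetDichotomyPolynomialSlackPinningNormalized
import Summits.MatrixMultiplication.MatrixMultiplication.Theorems.SnSubsetDichotomyPolynomialSlackTripleSplit
import Summits.MatrixMultiplication.MatrixMultiplication.Theorems.SnSubsetDichotomyPolynomialSlackMarginals
import Summits.MatrixMultiplication.MatrixMultiplication.Theorems.SnSubsetDichotomyPolynomialSlackPositivity
import Summits.MatrixMultiplication.MatrixMultiplication.Theorems.SnSubsetDichotomyPolynomialSlackStubSplit

/-!
# The Frobenius floor of the level-one programme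

Crux `Summit.MatrixMultiplication.MatrixMultiplication.Theses.SnSubsetDichotomy.PolynomialSlack`
(item `stmt-MatrixMultiplication-8306`), level-one programme, line transport-split-hull (lead c6,
"beyond one half"). For a parity-pure TPP triple `S, T, U ⊆ S_n` (`n ≥ 40`) of nonempty sets write
`N = |S||T||U|`, `F = n!√(n!)/N`, `D = n(n-1)/6`, and let `a`, `b`, `c` be the centred quotient
profiles `a_{ij} = m_{ST}(i,j)/(|S||T|) - 1/n` etc. (`m_{XY}(i,j) = #{(x,y) ∈ X × Y : y j = x i}`),
with co-densities `K_A = n!/(|S||T|)`, `K_B = n!/(|T||U|)`, `K_C = n!/(|U||S|)`, so that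
`K_A K_B K_C = n!³/N² = F²`.

* `centredProfile_energy_le` — Parseval for one pair: if `(x,y) ↦ x⁻¹y` is injective on `X × Y`
  then `(n-1)·Σ (m_{XY}/(|X||Y|) - 1/n)² ≤ n!/(|X||Y|)` (`excess_cap_pair` divided by `(|X||Y|)²`,
  centred by `sumSq_centered_eq`).
* `frobenius_floor` — the FROBENIUS FLOOR `(1 - n!/(2N) - n!√(n!)/(2N√D))·√(n-1) ≤ F`: the
  normalised pinning `pinning_normalized` (`1 - δ₀ ≤ -(n-1)·Σ abc`), the norm bound
  `neg_norms_le_tripleSum` (`-(n-1)Σ abc ≤ (n-1)‖a‖‖b‖‖c‖`) and the three Parseval bounds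
  (`‖a‖ ≤ √(K_A/(n-1))` etc.) give `1 - δ₀ ≤ √(K_A K_B K_C)/√(n-1) = F/√(n-1)`.
-/

namespace Summit.MatrixMultiplication.MatrixMultiplication.Theorems.PolynomialSlack

open scoped BigOperators
open Literature.Combinatorics.Additive (TripleProductProperty)

-- `Summit.<Summit>.<Problem>` is the tree's mandated summit-side namespace (CONVENTIONS §2); for
-- this single-conjunct summit the two coincide, so each declaration silences `dupNamespace`.
set_option linter.dupNamespace false

variable {n : ℕ}

/-- **Parseval for a centred quotient profile.** If `(x,y) ↦ x⁻¹y` is injective on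
`X × Y ⊆ S_n × S_n` (`n ≥ 40`, `X, Y` nonempty) then
`(n-1)·Σ_{i,j} (m_{XY}(i,j)/(|X||Y|) - 1/n)² ≤ n!/(|X||Y|)`: `excess_cap_pair` divided by
`(|X||Y|)²` is `(n-1)·Σ (m/(|X||Y|))² ≤ n!/(|X||Y|) + (n-2)`, and the rows of `m/(|X||Y|)` sum to
`1` (`sum_pairMarginal_snd`), so `sumSq_centered_eq` subtracts `n-1`. [folklore] -/
theorem centredProfile_energy_le (hn : 40 ≤ n) {X Y : Finset (Equiv.Perm (Fin n))}
    (hX : X.Nonempty) (hY : Y.Nonempty)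
    (hinj : Set.InjOn (fun xy : Equiv.Perm (Fin n) × Equiv.Perm (Fin n) => xy.1⁻¹ * xy.2)
      (↑X ×ˢ ↑Y : Set (Equiv.Perm (Fin n) × Equiv.Perm (Fin n)))) :
    ((n : ℝ) - 1) * ∑ i : Fin n, ∑ j : Fin n,
        ((((X ×ˢ Y).filter fun xy => xy.2 j = xy.1 i).card : ℝ) / (X.card * Y.card : ℕ) -
          1 / n) ^ 2 ≤
      (n.factorial : ℝ) / (X.card * Y.card : ℕ) := by
  classical
  have hn0 : n ≠ 0 := by omega
  set α : ℝ := ((X.card * Y.card : ℕ) : ℝ) with hα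
  have hα0 : 0 < α := by rw [hα]; exact_mod_cast Nat.mul_pos hX.card_pos hY.card_pos
  set m : Fin n → Fin n → ℝ := fun i j => (((X ×ˢ Y).filter fun xy => xy.2 j = xy.1 i).card : ℝ)
    with hm
  have hex : ((n : ℝ) - 1) * ∑ i : Fin n, ∑ j : Fin n, m i j ^ 2 ≤
      α * ((n.factorial : ℝ) + ((n : ℝ) - 2) * α) := excess_cap_pair hn hinj
  have hrow : ∀ i, ∑ j : Fin n, m i j = α := fun i => by
    have h : ∑ j : Fin n, ((((X ×ˢ Y).filter fun xy => xy.2 j = xy.1 i).card : ℕ) : ℝ) =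
        ((X.card * Y.card : ℕ) : ℝ) := by exact_mod_cast sum_pairMarginal_snd X Y i
    exact h
  set a : Fin n → Fin n → ℝ := fun i j => m i j / α with ha
  have har : ∀ i, ∑ j : Fin n, a i j = 1 := fun i => by
    simp only [ha]; rw [← Finset.sum_div, div_eq_one_iff_eq hα0.ne', hrow]
  have hcen := sumSq_centered_eq hn0 a har
  have hsq : ∑ i : Fin n, ∑ j : Fin n, a i j ^ 2 =
      (∑ i : Fin n, ∑ j : Fin n, m i j ^ 2) / α ^ 2 := by
    rw [Finset.sum_div]; refine Finset.sum_congr rfl fun i _ => ?_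
    rw [Finset.sum_div]; refine Finset.sum_congr rfl fun j _ => ?_
    rw [ha, div_pow]
  show ((n : ℝ) - 1) * ∑ i : Fin n, ∑ j : Fin n, (a i j - 1 / n) ^ 2 ≤ (n.factorial : ℝ) / α
  rw [hcen, hsq]
  set E : ℝ := ∑ i : Fin n, ∑ j : Fin n, m i j ^ 2 with hE
  clear_value E
  rw [show ((n : ℝ) - 1) * (E / α ^ 2 - 1) = (((n : ℝ) - 1) * E - ((n : ℝ) - 1) * α ^ 2) / α ^ 2 by
    field_simp]
  rw [div_le_div_iff₀ (pow_pos hα0 2) hα0]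
  nlinarith [mul_le_mul_of_nonneg_left hex hα0.le, pow_pos hα0 3]

/-- **Frobenius floor.** For `n ≥ 40` and a parity-pure TPP triple `S, T, U ⊆ S_n` of nonempty sets
with `N = |S||T||U|` and `D = n(n-1)/6`:
`(1 - n!/(2N) - n!√(n!)/(2N√D))·√(n-1) ≤ F = n!√(n!)/N`. Proof: `pinning_normalized` bounds the
left bracket by `-(n-1)·Σ_{ijk} a_{ij} b_{jk} c_{ki}` (centred quotient profiles),
`neg_norms_le_tripleSum` bounds that by `(n-1)‖a‖‖b‖‖c‖`, and Parseval (`centredProfile_energy_le`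
for the pairs `(S,T)`, `(T,U)`, `(U,S)`, injective by the TPP) gives `(n-1)‖a‖² ≤ K_A` etc. with
`K_A K_B K_C = F²`. [folklore] -/
theorem frobenius_floor {n : ℕ} (hn : 40 ≤ n) {S T U : Finset (Equiv.Perm (Fin n))}
    (hTPP : TripleProductProperty S T U) (hS0 : S.Nonempty) (hT0 : T.Nonempty) (hU0 : U.Nonempty)
    (hS : ∀ s ∈ S, ∀ s' ∈ S, Equiv.Perm.sign s = Equiv.Perm.sign s')
    (hT : ∀ t ∈ T, ∀ t' ∈ T, Equiv.Perm.sign t = Equiv.Perm.sign t')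
    (hU : ∀ u ∈ U, ∀ u' ∈ U, Equiv.Perm.sign u = Equiv.Perm.sign u') :
    (1 - ((n.factorial : ℝ) / (2 * (S.card * T.card * U.card : ℕ)) +
          (n.factorial : ℝ) * Real.sqrt (n.factorial : ℝ) /
            (2 * (S.card * T.card * U.card : ℕ) * Real.sqrt (((n * (n - 1) : ℕ) : ℝ) / 6)))) *
        Real.sqrt ((n : ℝ) - 1) ≤
      (n.factorial : ℝ) * Real.sqrt (n.factorial : ℝ) / (S.card * T.card * U.card : ℕ) := by
  classical
  -- the three centred quotient profiles
  set a : Fin n → Fin n → ℝ := fun i j =>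
    (((S ×ˢ T).filter fun st => st.2 j = st.1 i).card : ℝ) / (S.card * T.card : ℕ) - 1 / n with ha
  set b : Fin n → Fin n → ℝ := fun j k =>
    (((T ×ˢ U).filter fun tu => tu.2 k = tu.1 j).card : ℝ) / (T.card * U.card : ℕ) - 1 / n with hb
  set c : Fin n → Fin n → ℝ := fun k i =>
    (((U ×ˢ S).filter fun us => us.2 i = us.1 k).card : ℝ) / (U.card * S.card : ℕ) - 1 / n with hc
  -- (1) the normalised pinning
  have hpin : 1 - (n.factorial : ℝ) / (2 * (S.card * T.card * U.card : ℕ)) -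
      (n.factorial : ℝ) * Real.sqrt (n.factorial : ℝ) /
        (2 * (S.card * T.card * U.card : ℕ) * Real.sqrt (((n * (n - 1) : ℕ) : ℝ) / 6)) ≤
      -((n : ℝ) - 1) * ∑ i : Fin n, ∑ j : Fin n, ∑ k : Fin n, a i j * b j k * c k i :=
    pinning_normalized n hn S T U hTPP hS0 hT0 hU0 hS hT hU
  -- (2) the norm bound on the cyclic triple sum
  have hnn := neg_norms_le_tripleSum a b c
  -- (3) Parseval for the three pairs
  have hPA : ((n : ℝ) - 1) * ∑ i : Fin n, ∑ j : Fin n, a i j ^ 2 ≤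
      (n.factorial : ℝ) / (S.card * T.card : ℕ) :=
    centredProfile_energy_le hn hS0 hT0 (injOn_quot_first hTPP hU0)
  have hPB : ((n : ℝ) - 1) * ∑ i : Fin n, ∑ j : Fin n, b i j ^ 2 ≤
      (n.factorial : ℝ) / (T.card * U.card : ℕ) :=
    centredProfile_energy_le hn hT0 hU0 (injOn_quot_second hTPP hS0)
  have hPC : ((n : ℝ) - 1) * ∑ i : Fin n, ∑ j : Fin n, c i j ^ 2 ≤
      (n.factorial : ℝ) / (U.card * S.card : ℕ) :=
    centredProfile_energy_le hn hU0 hS0 (injOn_quot_first hTPP.rotate.rotate hT0)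
  -- (4) real bookkeeping
  set T3 : ℝ := ∑ i : Fin n, ∑ j : Fin n, ∑ k : Fin n, a i j * b j k * c k i with hT3
  set EA : ℝ := ∑ i : Fin n, ∑ j : Fin n, a i j ^ 2 with hEA
  set EB : ℝ := ∑ i : Fin n, ∑ j : Fin n, b i j ^ 2 with hEB
  set EC : ℝ := ∑ i : Fin n, ∑ j : Fin n, c i j ^ 2 with hEC
  clear_value T3 EA EB EC
  set N : ℝ := ((S.card * T.card * U.card : ℕ) : ℝ) with hN
  set α : ℝ := ((S.card * T.card : ℕ) : ℝ) with hα
  set β : ℝ := ((T.card * U.card : ℕ) : ℝ) with hβ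
  set γ : ℝ := ((U.card * S.card : ℕ) : ℝ) with hγ
  have hNpos : (0 : ℝ) < N := by
    rw [hN]; exact_mod_cast Nat.mul_pos (Nat.mul_pos hS0.card_pos hT0.card_pos) hU0.card_pos
  have hα0 : 0 < α := by rw [hα]; exact_mod_cast Nat.mul_pos hS0.card_pos hT0.card_pos
  have hβ0 : 0 < β := by rw [hβ]; exact_mod_cast Nat.mul_pos hT0.card_pos hU0.card_pos
  have hγ0 : 0 < γ := by rw [hγ]; exact_mod_cast Nat.mul_pos hU0.card_pos hS0.card_pos
  have hNsq : α * β * γ = N ^ 2 := by rw [hα, hβ, hγ, hN]; push_cast; ring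
  clear_value N α β γ
  have hn1 : (0 : ℝ) < (n : ℝ) - 1 := by
    have : (40 : ℝ) ≤ n := by exact_mod_cast hn
    linarith
  set r : ℝ := Real.sqrt ((n : ℝ) - 1) with hr
  have hrr : r * r = (n : ℝ) - 1 := Real.mul_self_sqrt hn1.le
  have hr0 : 0 ≤ r := Real.sqrt_nonneg _
  set F : ℝ := (n.factorial : ℝ) * Real.sqrt (n.factorial : ℝ) / N with hF
  have hF0 : 0 ≤ F := div_nonneg (mul_nonneg (Nat.cast_nonneg _) (Real.sqrt_nonneg _)) hNpos.le
  set KA : ℝ := (n.factorial : ℝ) / α with hKA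
  set KB : ℝ := (n.factorial : ℝ) / β with hKB
  set KC : ℝ := (n.factorial : ℝ) / γ with hKC
  have hKA0 : 0 ≤ KA := div_nonneg (Nat.cast_nonneg _) hα0.le
  have hKB0 : 0 ≤ KB := div_nonneg (Nat.cast_nonneg _) hβ0.le
  have hK : KA * KB * KC = F ^ 2 := by
    rw [hKA, hKB, hKC, hF, div_mul_div_comm, div_mul_div_comm, hNsq, div_pow, mul_pow,
      Real.sq_sqrt (Nat.cast_nonneg _)]
    ring
  have hsK : Real.sqrt KA * Real.sqrt KB * Real.sqrt KC = F := by
    rw [← Real.sqrt_mul hKA0, ← Real.sqrt_mul (mul_nonneg hKA0 hKB0), hK, Real.sqrt_sq hF0]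
  -- the norms
  set sA : ℝ := Real.sqrt EA with hsA
  set sB : ℝ := Real.sqrt EB with hsB
  set sC : ℝ := Real.sqrt EC with hsC
  have hA1 : r * sA ≤ Real.sqrt KA := by
    rw [hr, hsA, ← Real.sqrt_mul hn1.le]; exact Real.sqrt_le_sqrt hPA
  have hB1 : r * sB ≤ Real.sqrt KB := by
    rw [hr, hsB, ← Real.sqrt_mul hn1.le]; exact Real.sqrt_le_sqrt hPB
  have hC1 : r * sC ≤ Real.sqrt KC := by
    rw [hr, hsC, ← Real.sqrt_mul hn1.le]; exact Real.sqrt_le_sqrt hPC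
  have hsA0 : 0 ≤ r * sA := mul_nonneg hr0 (Real.sqrt_nonneg _)
  have hsB0 : 0 ≤ r * sB := mul_nonneg hr0 (Real.sqrt_nonneg _)
  have hsC0 : 0 ≤ r * sC := mul_nonneg hr0 (Real.sqrt_nonneg _)
  have hprod : r * sA * (r * sB) * (r * sC) ≤ Real.sqrt KA * Real.sqrt KB * Real.sqrt KC :=
    mul_le_mul (mul_le_mul hA1 hB1 hsB0 (Real.sqrt_nonneg _)) hC1 hsC0
      (mul_nonneg (Real.sqrt_nonneg _) (Real.sqrt_nonneg _))
  -- the left bracket is at most `(n-1)·‖a‖‖b‖‖c‖`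
  have hL : 1 - ((n.factorial : ℝ) / (2 * N) +
      (n.factorial : ℝ) * Real.sqrt (n.factorial : ℝ) /
        (2 * N * Real.sqrt (((n * (n - 1) : ℕ) : ℝ) / 6))) ≤ ((n : ℝ) - 1) * (sA * sB * sC) := by
    have h2 := mul_le_mul_of_nonneg_left hnn hn1.le
    linarith
  calc (1 - ((n.factorial : ℝ) / (2 * N) +
          (n.factorial : ℝ) * Real.sqrt (n.factorial : ℝ) /
            (2 * N * Real.sqrt (((n * (n - 1) : ℕ) : ℝ) / 6)))) * r
      ≤ ((n : ℝ) - 1) * (sA * sB * sC) * r := mul_le_mul_of_nonneg_right hL hr0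
    _ = r * sA * (r * sB) * (r * sC) := by rw [← hrr]; ring
    _ ≤ Real.sqrt KA * Real.sqrt KB * Real.sqrt KC := hprod
    _ = F := hsK

end Summit.MatrixMultiplication.MatrixMultiplication.Theorems.PolynomialSlack
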